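import Literature.AlgebraicGeometry.Resolution.DerivativeIdealSheaf
import Literature.AlgebraicGeometry.Motives.AlgPointsSeparate
import Mathlib.AlgebraicGeometry.ResidueField
import Mathlib.AlgebraicGeometry.Stalk
import Mathlib.RingTheory.Etale.Field
import Mathlib.FieldTheory.Perfect
import HarnessLib

/-!
# Residue fields at closed points are formally smooth over a perfect ground field (B2′ ⊇, last formal residue)

Route `ResolutionOfSingularities/WeightedInvariant`, crux `WeightedConstruction`
(stmt-ResolutionOfSingularities-0571), line `pointwise-lexmax-hull`, stub `stub_plexComap` (B2′), ⊇-half.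
[OURS · L1 W4.3] Discharges the hypothesis `hκ` of `admissibleProfileAt_comap_of_smooth` /
`plex_le_plex_comap_of_smooth` (`Theorems/…PlexComapAdmissible.lean`): for `Y` locally of finite type
over a PERFECT field `k` and a CLOSED point `y`, the residue field `κ(y)` — with the `k`-structure
`k ≅ Γ(Spec k) → Γ(Y, 𝒪_Y) → 𝒪_{Y,y} → κ(y)` of the tree's `stalkAlgebra` — is a finite
(`Literature.AlgebraicGeometry.Motives.finite_preimage_fromSpecResidueField`, Jacobson), hence separable
(`k` perfect), hence formally étale, hence formally smooth `k`-algebra.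

* `specMap_residue_germ_appTop` — `Spec` of `k ≅ Γ(Spec k) → Γ(Y,𝒪) → 𝒪_{Y,y} → κ(y)` is
  `Y.fromSpecResidueField y ≫ f`.
* `formallySmooth_residueField_stalk_of_isClosed` — the statement.

No new mathematics; NOT a statement of the manuscript under review.
-/

noncomputable section

set_option linter.dupNamespace false -- mandated namespace of this single-conjunct summit

open CategoryTheory CategoryTheory.Limits AlgebraicGeometry TopologicalSpace IsLocalRing
open Literature.AlgebraicGeometry.Resolution

namespace Summit.ResolutionOfSingularities.ResolutionOfSingularities.Theorems

/-- **The `k`-structure of `κ(y)` through `Spec`.** For `f : Y → Spec k`: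
`Spec (k ≅ Γ(Spec k, 𝒪) → Γ(Y, 𝒪_Y) → 𝒪_{Y,y} → κ(y)) = (Spec κ(y) → Y → Spec k)`. [folklore] -/
theorem specMap_residue_germ_appTop ⦃k : Type⦄ [Field k] ⦃Y : Scheme.{0}⦄
    (f : Y ⟶ Spec (.of k)) (y : Y) :
    Spec.map ((Scheme.ΓSpecIso (.of k)).inv ≫ f.appTop ≫ Y.presheaf.germ ⊤ y trivial ≫
      Y.residue y) = Y.fromSpecResidueField y ≫ f := by
  have h2 : Y.fromSpecStalk y ≫ f = Spec.map (Y.presheaf.germ ⊤ y trivial) ≫ Spec.map f.appTop ≫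
      Spec.map (Scheme.ΓSpecIso (.of k)).inv := by
    calc Y.fromSpecStalk y ≫ f
        = Y.fromSpecStalk y ≫ (f ≫ (Spec (.of k)).toSpecΓ ≫
            Spec.map (Scheme.ΓSpecIso (.of k)).inv) := by
          rw [toSpecΓ_SpecMap_ΓSpecIso_inv, Category.comp_id]
      _ = (Y.fromSpecStalk y ≫ Y.toSpecΓ) ≫ Spec.map f.appTop ≫
            Spec.map (Scheme.ΓSpecIso (.of k)).inv := by
          rw [Scheme.toSpecΓ_naturality_assoc, Category.assoc]
      _ = Spec.map (Y.presheaf.germ ⊤ y trivial) ≫ Spec.map f.appTop ≫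
            Spec.map (Scheme.ΓSpecIso (.of k)).inv := by
          rw [Scheme.fromSpecStalk_toSpecΓ]
  rw [Scheme.fromSpecResidueField, Category.assoc, h2]
  simp only [Spec.map_comp, Category.assoc]

/-- **Residue fields at closed points are formally smooth over a perfect ground field.** For `Y`
locally of finite type over a perfect field `k` and a closed point `y`, `κ(y)` is finite over `k`
(closed points of Jacobson schemes), hence separable (`k` perfect), hence formally étale / smooth — for
the `k`-structure of `stalkAlgebra`. [folklore] -/
theorem formallySmooth_residueField_stalk_of_isClosed ⦃k : Type⦄ [Field k] [PerfectField k]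
    ⦃Y : Scheme.{0}⦄ (f : Y ⟶ Spec (.of k)) [LocallyOfFiniteType f] (y : Y)
    (hy : IsClosed ({y} : Set Y)) :
    letI := stalkAlgebra (f.appTop.hom.comp (Scheme.ΓSpecIso (.of k)).inv.hom) y
    Algebra.FormallySmooth k (ResidueField (Y.presheaf.stalk y)) := by
  letI algP : Algebra k (Y.presheaf.stalk y) :=
    stalkAlgebra (f.appTop.hom.comp (Scheme.ΓSpecIso (.of k)).inv.hom) y
  have hpre : Spec.preimage (Y.fromSpecResidueField y ≫ f) =
      (Scheme.ΓSpecIso (.of k)).inv ≫ f.appTop ≫ Y.presheaf.germ ⊤ y trivial ≫ Y.residue y := by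
    rw [← specMap_residue_germ_appTop f y, Spec.preimage_map]
  have halg : ((Scheme.ΓSpecIso (.of k)).inv ≫ f.appTop ≫ Y.presheaf.germ ⊤ y trivial ≫
      Y.residue y).hom = algebraMap k (ResidueField (Y.presheaf.stalk y)) :=
    RingHom.ext fun _ => rfl
  have hfin : (algebraMap k (ResidueField (Y.presheaf.stalk y))).Finite := by
    have h := Literature.AlgebraicGeometry.Motives.finite_preimage_fromSpecResidueField f hy
    rw [hpre, halg] at h
    exact h
  haveI : Module.Finite k (ResidueField (Y.presheaf.stalk y)) :=
    (RingHom.finite_algebraMap).mp hfin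
  haveI : Algebra.IsSeparable k (ResidueField (Y.presheaf.stalk y)) :=
    Algebra.IsAlgebraic.isSeparable_of_perfectField
  haveI : Algebra.FormallyEtale k (ResidueField (Y.presheaf.stalk y)) :=
    Algebra.FormallyEtale.of_isSeparable k (ResidueField (Y.presheaf.stalk y))
  infer_instance

end Summit.ResolutionOfSingularities.ResolutionOfSingularities.Theorems

end
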